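import Mathlib
import HarnessLib
import Summits.HubbardSuperconductivity.HubbardSuperconductivity.Theorems.KLProgrammeKLRegimeEnginePairTransferMemberPHCrossedSigned

/-!
# Route `KLProgramme` — ENGINE item stmt-HubbardSuperconductivity-20437 `KLRegimeEngineV17F2`, class-#5 STEP (X).3 rows form (row `hQ`, crossed class `RQ`):
# THE SIGNED CROSSED ROW, ASSEMBLED — the frequency-shifted pinned bubble (`|q₀| ≤ Λₙ₊₁/8`) through `klfl_lattice_soft_bubble_norm_le_model` and the
# crossed row keyed on LATTICE kernel data `(A₀, L_A, ε)` (cell gate-hubbard-kl, seat hubbard-kl-k3c2-p2 g17)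

* `klms_pinned_bubble_shift_norm_le` — `klms_pinned_bubble_norm_le` (…MemberPHSignedRow) with a frequency shift `q₀` on the partner line: bound
  `βL²·klmsRowBound … (|q₀| + G·|p_q̃|_𝕋) L`;
* **`klms_memberPH_crossed_signed_le`** — `‖S_Q‖ ≤ (βL²)²·(βL²·Row(|−2π/β| + G|p_q̃|_𝕋) + βL²·Row(|2π/β| + G|p_q̃|_𝕋)) + ε·(256/3)(βL²)²/Λ(t)²·Σ|Φ_j(t)|‖ĝ_K‖`,
  `q̃ = Q_m − x − y`, from `klms_memberPH_crossed_norm_le` (…MemberPHCrossedSigned).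

Pure composition; nothing about the model's effective action is asserted; nothing asserts (X).3, (c), K3 or superconductivity.
-/

noncomputable section

namespace Summit.HubbardSuperconductivity.HubbardSuperconductivity.Theorems.KLRegimeSplit

set_option linter.dupNamespace false -- summit = problem name (single-conjunct summit), D-0017

open Real Set Finset Complex Literature.MathematicalPhysics.QuantumLattice
open Literature.Probability.LatticeModels hiding torusSupNorm
open Literature.MathematicalPhysics.QuantumLattice.BandSectorCounting
open Summit.HubbardSuperconductivity.HubbardSuperconductivity.Theorems.KLProgrammeLegKernels
open Summit.HubbardSuperconductivity.HubbardSuperconductivity.Theorems.KLRegimeWick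
open Summit.HubbardSuperconductivity.HubbardSuperconductivity.Theorems.TwoPointAssembly
open Summit.HubbardSuperconductivity.HubbardSuperconductivity.Theorems.DispersionFlow
open Summit.HubbardSuperconductivity.HubbardSuperconductivity.Theorems.PerturbedFermiCurve

variable {L M : ℕ} [NeZero L] [NeZero M] (β μ : ℝ) (K : TrigPolyC4v)

/-! ## The pinned bubble with a frequency shift, and the assembled crossed row -/

section Model

variable {a' b' : ℝ} (B : BandBounds a' b') {R : RenConsts} {U : ℝ} {N : ℕ} {A : ℝ}

omit [NeZero M] in
/-- `klms_pinned_bubble_norm_le` with a frequency shift `|q₀| ≤ Λₙ₊₁/8` on the partner line: bound `βL²·klmsRowBound … (|q₀| + G·|p_q̃|_𝕋) L`. -/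
theorem klms_pinned_bubble_shift_norm_le (hR : ∀ j, 0 ≤ R.Gfr j) (hK : FrameOK R U N μ K)
    (hAb : ∀ p : Momentum, ∀ j ≤ 2, ‖iteratedFDeriv ℝ j (frameShift K) p‖ ≤ A) (hA : 4 * A < B.Dtmin) (hA20 : 4 * A ≤ 1 / 20) (hμ : μ ≤ -0.15)
    (n : ℕ) {t : ℝ} (ht : t ∈ Icc (0 : ℝ) 1) {j : ℕ} (hj : n + 1 ≤ j)
    (hlo : a' < μ - 4 * klScale klE0 (n + 1) - 4 * A) (hhi : μ + 4 * klScale klE0 (n + 1) + 4 * A < b')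
    (hβ : klBetaMin ≤ β) (hn : n + 1 ≤ nScales β + 1) (hM : β * (4 * klScale klE0 (n + 1)) / (2 * Real.pi) + 1 ≤ M)
    (q : TorusSite 2 L) (hq : (4 + 8 / 3 * R.Gfr 1 * U ^ 2) * klTorusNorm L q ≤ klScale klE0 (n + 1) / 8) {q₀ : ℝ} (hq₀ : |q₀| ≤ klScale klE0 (n + 1) / 8)
    {Y : TorusSite 2 L → ℂ} {A₀ LA : ℝ} (hA0 : 0 ≤ A₀) (hLA : 0 ≤ LA) (hY0 : ∀ k, ‖Y k‖ ≤ A₀)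
    (hY1 : ∀ k k', ‖Y k - Y k'‖ ≤ LA * klTorusNorm L (k - k')) :
    ‖∑ p : FreqMomentum L M, Y p.2 *
        (klfb_prop (klWdC (klScale klE0 n + t * (klScale klE0 (n + 1) - klScale klE0 n))) (matsubaraFreq β M p.1) (nambuXiCT L μ K p.2) *
          klfb_prop (klPhiC (klScale klE0 j) (klScale klE0 n + t * (klScale klE0 (n + 1) - klScale klE0 n))) (matsubaraFreq β M p.1 + q₀)
            (nambuXiCT L μ K (p.2 + q)))‖ ≤
      β * (L : ℝ) ^ 2 * klmsRowBound B.Dtmin A (4 + 8 / 3 * R.Gfr 1 * U ^ 2) A₀ LA β n j (|q₀| + (4 + 8 / 3 * R.Gfr 1 * U ^ 2) * klTorusNorm L q) L := by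
  set Λt : ℝ := klScale klE0 n + t * (klScale klE0 (n + 1) - klScale klE0 n) with hΛt
  obtain ⟨hlo', hhi'⟩ := scaleAt_mem n ht
  have hΛ1 := klth_klScale_pos (n + 1)
  have hβ0 : 0 < β := lt_of_lt_of_le (by norm_num [klBetaMin]) hβ
  set a : ℝ × ℝ → ℂ := klpeExt Y A₀ LA with ha
  obtain ⟨hbd, hlip, hin, hout⟩ := klfw_sliceWeight_hypotheses hlo' hhi'
  obtain ⟨hdbd, hdlip, hdout, -⟩ := klfw_partner_hypotheses hlo' hhi' hj
  obtain ⟨hFbd, hFlip⟩ := klfw_product_hypotheses hlo' hhi' hj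
  have hLf' : 8 / klScale klE0 j ^ 2 ≤ 8 * (16 : ℝ) ^ (j - (n + 1)) / klScale klE0 (n + 1) ^ 2 := (klfw_partner_lipschitz_scale hj).le
  have hLF : 8 / klScale klE0 (n + 1) * (8 / klScale klE0 j ^ 2) + 1 * ((2 * (448 / 3 * Real.exp 2) + 8) / klScale klE0 (n + 1) / klScale klE0 (n + 1) ^ 2) ≤
      (8 / klScale klE0 (n + 1) * (8 / klScale klE0 j ^ 2) + 1 * ((2 * (448 / 3 * Real.exp 2) + 8) / klScale klE0 (n + 1) / klScale klE0 (n + 1) ^ 2)) *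
          klScale klE0 (n + 1) ^ 2 / klScale klE0 (n + 1) ^ 2 :=
    le_of_eq (by rw [mul_div_cancel_right₀ _ (pow_ne_zero 2 hΛ1.ne')])
  have h := klfl_lattice_soft_bubble_norm_le_model B hR hK hAb hA hA20 hμ (klpe_continuous_ext Y A₀ hLA) (klpe_ext_periodic₁ Y A₀ LA)
    (klpe_ext_periodic₂ Y A₀ LA) (klpe_norm_ext_le Y hA0 LA) (klpe_ext_lipschitz Y A₀ hLA) (n := n + 1) (Nat.le_add_left 1 n) q hq
    hlip hbd le_rfl hin hout hdlip hdbd hLf' hdout (by positivity) hFlip hFbd hLF hlo hhi hq₀ hβ hn hM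
  have hsum : (∑ p : FreqMomentum L M, Y p.2 *
        (klfb_prop (klWdC Λt) (matsubaraFreq β M p.1) (nambuXiCT L μ K p.2) *
          klfb_prop (klPhiC (klScale klE0 j) Λt) (matsubaraFreq β M p.1 + q₀) (nambuXiCT L μ K (p.2 + q)))) =
      (((β * (L : ℝ) ^ 2 : ℝ)) : ℂ) * (β⁻¹ • ∑ i : MatsubaraIdx M, ((L ^ 2 : ℕ) : ℝ)⁻¹ • ∑ k : TorusSite 2 L,
        a (latticeMomentum L k 0, latticeMomentum L k 1) * klfb_prop (klWdC Λt) (matsubaraFreq β M i) (nambuXiCT L μ K k) *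
          klfb_prop (klPhiC (klScale klE0 j) Λt) (matsubaraFreq β M i + q₀) (nambuXiCT L μ K (k + q))) := by
    rw [← klrf_sum_freqMomentum_eq_smul hβ0.ne']
    refine Finset.sum_congr rfl fun p _ => ?_
    rw [ha, klpe_ext_apply_latticeMomentum hY0 hY1, mul_assoc]
  rw [hsum, norm_mul, Complex.norm_real, Real.norm_of_nonneg (by positivity)]
  refine mul_le_mul_of_nonneg_left ?_ (by positivity)
  unfold klmsRowBound
  rw [abs_zero, zero_add]
  exact h

/-- **THE SIGNED CROSSED ROW, ASSEMBLED** (see the module docstring): `‖S_Q‖ ≤ (βL²)²·(βL²·Row(2π/β + G|p_q̃|_𝕋) + βL²·Row(2π/β + G|p_q̃|_𝕋)) + ε·flat`,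
`q̃ = Q_m − x − y`, keyed on the lattice data of the two pinned kernel products. -/
theorem klms_memberPH_crossed_signed_le (hR : ∀ j, 0 ≤ R.Gfr j) (hK : FrameOK R U N μ K)
    (hAb : ∀ p : Momentum, ∀ j ≤ 2, ‖iteratedFDeriv ℝ j (frameShift K) p‖ ≤ A) (hA : 4 * A < B.Dtmin) (hA20 : 4 * A ≤ 1 / 20) (hμ : μ ≤ -0.15)
    (n : ℕ) {t : ℝ} (ht : t ∈ Icc (0 : ℝ) 1) (hβ : klBetaMin ≤ β) (hn : n + 1 ≤ nScales β + 1) (hβn : 16 * π / β ≤ klScale klE0 (n + 1))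
    (hM : β * (4 * klScale klE0 (n + 1)) / (2 * Real.pi) + 1 ≤ M)
    (Φ : ℕ → ℝ → FreqMomentum L M → ℝ) (hΦ : Φ = fun j t k => (softSymbolCompl L M β μ K (n + 1) j) k + (hubbardCutoffWeightCT L M β μ K (klScale klE0 (n + 1)) k -
            hubbardCutoffWeightCT L M β μ K (klScale klE0 n + t * (klScale klE0 (n + 1) - klScale klE0 n)) k))
    (Wd : ℝ → FreqMomentum L M → ℝ) (hWd : Wd = fun t k => deriv (fun Λ' : ℝ => hubbardCutoffWeightCT L M β μ K Λ' k) (klScale klE0 n + t * (klScale klE0 (n + 1) - klScale klE0 n)))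
    (V : ℕ → ℝ → (Fin 4 → HubbardFieldIdx L M) → ℂ) {j : ℕ} (hj : n + 1 ≤ j) (Qm x y : TorusSite 2 L)
    (hlo : a' < μ - 4 * klScale klE0 (n + 1) - 4 * A) (hhi : μ + 4 * klScale klE0 (n + 1) + 4 * A < b')
    (hq : (4 + 8 / 3 * R.Gfr 1 * U ^ 2) * klTorusNorm L (Qm - x - y) ≤ klScale klE0 (n + 1) / 8)
    {A₀ LA ε : ℝ} (hA0 : 0 ≤ A₀) (hLA : 0 ≤ LA) (hε : 0 ≤ ε)
    (hY0B : ∀ k : TorusSite 2 L, ‖V j t ![(((omega0 M, k), 0), 1), ((((omega0 M).rev, k + (Qm - x - y)), 1), 0), (((omega0 M, y), 0), 0), ((((omega0 M).rev, Qm - x), 1), 1)] *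
        V j t ![(((omega0 M, k), 0), 0), ((((omega0 M).rev, k + (Qm - x - y)), 1), 1), ((((omega0 M).rev, Qm - y), 1), 0), (((omega0 M, x), 0), 1)]‖ ≤ A₀)
    (hY1B : ∀ k k' : TorusSite 2 L,
      ‖V j t ![(((omega0 M, k), 0), 1), ((((omega0 M).rev, k + (Qm - x - y)), 1), 0), (((omega0 M, y), 0), 0), ((((omega0 M).rev, Qm - x), 1), 1)] *
            V j t ![(((omega0 M, k), 0), 0), ((((omega0 M).rev, k + (Qm - x - y)), 1), 1), ((((omega0 M).rev, Qm - y), 1), 0), (((omega0 M, x), 0), 1)] -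
          V j t ![(((omega0 M, k'), 0), 1), ((((omega0 M).rev, k' + (Qm - x - y)), 1), 0), (((omega0 M, y), 0), 0), ((((omega0 M).rev, Qm - x), 1), 1)] *
            V j t ![(((omega0 M, k'), 0), 0), ((((omega0 M).rev, k' + (Qm - x - y)), 1), 1), ((((omega0 M).rev, Qm - y), 1), 0), (((omega0 M, x), 0), 1)]‖ ≤
        LA * klTorusNorm L (k - k'))
    (hY0A : ∀ k : TorusSite 2 L, ‖V j t ![(((omega0 M, k + -(Qm - x - y)), 0), 1), ((((omega0 M).rev, k), 1), 0), (((omega0 M, y), 0), 0), ((((omega0 M).rev, Qm - x), 1), 1)] *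
        V j t ![(((omega0 M, k + -(Qm - x - y)), 0), 0), ((((omega0 M).rev, k), 1), 1), ((((omega0 M).rev, Qm - y), 1), 0), (((omega0 M, x), 0), 1)]‖ ≤ A₀)
    (hY1A : ∀ k k' : TorusSite 2 L,
      ‖V j t ![(((omega0 M, k + -(Qm - x - y)), 0), 1), ((((omega0 M).rev, k), 1), 0), (((omega0 M, y), 0), 0), ((((omega0 M).rev, Qm - x), 1), 1)] *
            V j t ![(((omega0 M, k + -(Qm - x - y)), 0), 0), ((((omega0 M).rev, k), 1), 1), ((((omega0 M).rev, Qm - y), 1), 0), (((omega0 M, x), 0), 1)] -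
          V j t ![(((omega0 M, k' + -(Qm - x - y)), 0), 1), ((((omega0 M).rev, k'), 1), 0), (((omega0 M, y), 0), 0), ((((omega0 M).rev, Qm - x), 1), 1)] *
            V j t ![(((omega0 M, k' + -(Qm - x - y)), 0), 0), ((((omega0 M).rev, k'), 1), 1), ((((omega0 M).rev, Qm - y), 1), 0), (((omega0 M, x), 0), 1)]‖ ≤
        LA * klTorusNorm L (k - k'))
    (hflat : ∀ (i i' : MatsubaraIdx M) (k k' : TorusSite 2 L), matsubaraInt M i' + 1 = matsubaraInt M i →
      matsubaraFreq β M i ^ 2 ≤ (5 * klScale klE0 (n + 1)) ^ 2 →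
      ‖V j t ![(((i, k), 0), 1), (((i', k'), 1), 0), (((omega0 M, y), 0), 0), ((((omega0 M).rev, Qm - x), 1), 1)] *
            V j t ![(((i, k), 0), 0), (((i', k'), 1), 1), ((((omega0 M).rev, Qm - y), 1), 0), (((omega0 M, x), 0), 1)] -
          V j t ![(((omega0 M, k), 0), 1), ((((omega0 M).rev, k'), 1), 0), (((omega0 M, y), 0), 0), ((((omega0 M).rev, Qm - x), 1), 1)] *
            V j t ![(((omega0 M, k), 0), 0), ((((omega0 M).rev, k'), 1), 1), ((((omega0 M).rev, Qm - y), 1), 0), (((omega0 M, x), 0), 1)]‖ ≤ ε) :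
    ‖∑ p : FreqMomentum L M, ∑ p' : FreqMomentum L M,
        if matsubaraInt M p'.1 + matsubaraInt M (omega0 M) + matsubaraInt M (omega0 M) + 1 = matsubaraInt M p.1 ∧ p'.2 = p.2 + Qm - x - y then
          ((((((Φ j t p) : ℝ) : ℂ) * (((β * (L : ℝ) ^ 2 : ℝ) : ℂ) * propCT L M β μ K p)) * ((((Wd t p') : ℝ) : ℂ) * (((β * (L : ℝ) ^ 2 : ℝ) : ℂ) * propCT L M β μ K p'))) +
              (((((Wd t p) : ℝ) : ℂ) * (((β * (L : ℝ) ^ 2 : ℝ) : ℂ) * propCT L M β μ K p)) * ((((Φ j t p') : ℝ) : ℂ) * (((β * (L : ℝ) ^ 2 : ℝ) : ℂ) * propCT L M β μ K p')))) *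
            (V j t ![((p, 0), 1), ((p', 1), 0), (((omega0 M, y), 0), 0), ((((omega0 M).rev, Qm - x), 1), 1)] *
              V j t ![((p, 0), 0), ((p', 1), 1), ((((omega0 M).rev, Qm - y), 1), 0), (((omega0 M, x), 0), 1)])
        else 0‖ ≤
      (β * (L : ℝ) ^ 2) ^ 2 *
          (β * (L : ℝ) ^ 2 * klmsRowBound B.Dtmin A (4 + 8 / 3 * R.Gfr 1 * U ^ 2) A₀ LA β n j
              (|-(2 * π / β)| + (4 + 8 / 3 * R.Gfr 1 * U ^ 2) * klTorusNorm L (Qm - x - y)) L +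
            β * (L : ℝ) ^ 2 * klmsRowBound B.Dtmin A (4 + 8 / 3 * R.Gfr 1 * U ^ 2) A₀ LA β n j
              (|2 * π / β| + (4 + 8 / 3 * R.Gfr 1 * U ^ 2) * klTorusNorm L (Qm - x - y)) L) +
        ε * (256 / 3 * (β * (L : ℝ) ^ 2) ^ 2 / (klScale klE0 n + t * (klScale klE0 (n + 1) - klScale klE0 n)) ^ 2 *
          ∑ p : FreqMomentum L M, |Φ j t p| * ‖propCT L M β μ K p‖) := by
  have hβ0 : 0 < β := lt_of_lt_of_le (by norm_num [klBetaMin]) hβ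
  have h0 := klms_memberPH_crossed_norm_le β μ K hβ0 n ht hβn hM Φ hΦ Wd hWd V j Qm x y hε hflat
  have h2π : |2 * π / β| ≤ klScale klE0 (n + 1) / 8 := by
    rw [abs_of_pos (by positivity)]
    have : 2 * π / β = (16 * π / β) / 8 := by ring
    rw [this]; exact div_le_div_of_nonneg_right hβn (by norm_num)
  have h2π' : |-(2 * π / β)| ≤ klScale klE0 (n + 1) / 8 := by rw [abs_neg]; exact h2π
  refine h0.trans (add_le_add (mul_le_mul_of_nonneg_left (add_le_add ?_ ?_) (by positivity)) le_rfl)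
  · exact klms_pinned_bubble_shift_norm_le β μ K B hR hK hAb hA hA20 hμ n ht hj hlo hhi hβ hn hM (Qm - x - y) hq h2π' hA0 hLA
      (Y := fun k : TorusSite 2 L =>
        V j t ![(((omega0 M, k), 0), 1), ((((omega0 M).rev, k + (Qm - x - y)), 1), 0), (((omega0 M, y), 0), 0), ((((omega0 M).rev, Qm - x), 1), 1)] *
          V j t ![(((omega0 M, k), 0), 0), ((((omega0 M).rev, k + (Qm - x - y)), 1), 1), ((((omega0 M).rev, Qm - y), 1), 0), (((omega0 M, x), 0), 1)])
      hY0B hY1B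
  · have hq' : (4 + 8 / 3 * R.Gfr 1 * U ^ 2) * klTorusNorm L (-(Qm - x - y)) ≤ klScale klE0 (n + 1) / 8 := by rwa [klTorusNorm_neg]
    have h := klms_pinned_bubble_shift_norm_le β μ K B hR hK hAb hA hA20 hμ n ht hj hlo hhi hβ hn hM (-(Qm - x - y)) hq' h2π hA0 hLA
      (Y := fun k : TorusSite 2 L =>
        V j t ![(((omega0 M, k + -(Qm - x - y)), 0), 1), ((((omega0 M).rev, k), 1), 0), (((omega0 M, y), 0), 0), ((((omega0 M).rev, Qm - x), 1), 1)] *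
          V j t ![(((omega0 M, k + -(Qm - x - y)), 0), 0), ((((omega0 M).rev, k), 1), 1), ((((omega0 M).rev, Qm - y), 1), 0), (((omega0 M, x), 0), 1)])
      hY0A hY1A
    rw [klTorusNorm_neg] at h
    exact h

end Model

end Summit.HubbardSuperconductivity.HubbardSuperconductivity.Theorems.KLRegimeSplit

end
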